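import Literature.AlgebraicGeometry.Resolution.ValuationConjugacy
import Literature.AlgebraicGeometry.Resolution.DefectAmbient
import Mathlib.FieldTheory.Galois.Basic
import Mathlib.FieldTheory.IsAlgClosed.Basic
import HarnessLib

/-!
# Descent of defectlessness (Kuhlmann 2010, Cor. 2.25), base step: `F` is defectless in `F·N`

Topic: `Literature/AlgebraicGeometry/Resolution` (valued function fields). First half of the
finite-level proof of the named fact `Kuhlmann2010DefectlessDescent`
(`GeneralizedStabilityTrdegOne.lean`) = F.-V. Kuhlmann, *Elimination of ramification I*, Trans.
AMS 362 (2010) = arXiv:1003.5678, **Cor. 2.25** for an extension `(F|K, v)` with `vF/vK` torsion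
free and `Fv = Kv`. Setting: an ambient algebraically closed valued field `(Ω, V)`, algebraic over
the intermediate field `F` of `Ω/K`; the hypotheses of Cor. 2.25 in the form of Lemma 2.20 are
"`vF/vK` is torsion free" and `Fv = Kv`, inside `vΩ` and `Ωv`. For a polynomial `p ∈ K[X]` let
`N = K(roots of p) ⊆ Ω` (a finite normal extension of `K`), `K_N = N ∩ F` and
`F₁ = F·N = F(roots of p)`. We PROVE:

> if `(K, v)` is a defectless field, then `(F, v)` is defectless in `F₁ = F·N`.

This is the finite-level content of Prop. 2.24 of the source ("Take an extension `(F|K,v)` of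
henselian fields and a finite algebraic extension `(L|K,v)`, valuation disjoint from `(F|K,v)` …
Then `d(L|K,v) ≥ d(L.F|F,v)`", proof: "`(v(L.F):vF) ≥ (vL+vF:vF) = (vL:vK)`,
`[L.Fv : Fv] ≥ [Lv.Fv : Fv] = [Lv : Kv]` … together with `[(L.F)^h:F^h] ≤ [L^h:K^h]`"), with the
henselizations replaced by a count of ALL the extensions of the valuation: over the finite normal
extensions `N/K_N` and `F₁/F` all extensions of the valuation are conjugate
(`ValuationConjugacy.lean`), so `∑ e f = g·e·f` on both sides; `e(F₁/F) ≥ e(N/K_N)` and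
`f(F₁/F) ≥ f(N/K_N)` at `V` by the displayed inequalities (`DefectAmbient.lean`: `vF ∩ vN ⊆ vK`
because `vF/vK` is torsion free, and `Fv = Kv`); `[F₁ : F] ≤ [N : K_N]`; and `g(F₁/F) ≥ g(N/K_N)`
because every `K_N`-automorphism of `N` is the restriction of an `F`-automorphism of `F₁`
(`exists_algEquiv_restricts`: the restrictions form a subgroup of `Aut(N/K_N)` whose fixed field
is that of the whole group — an element of `N` fixed by all of `Aut(F₁/F)` is purely inseparable
over `F`, `exists_pow_mem_range_of_forall_algEquiv`, hence fixed by `Aut(N/K_N)` as `K_N = N ∩ F` —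
and a subgroup with the same fixed field is everything, `IntermediateField.fixingSubgroup_fixedField`).
With `K_N` defectless (Cor. 2.16) this gives
`g e f (F₁/F) ≥ g e f (N/K_N) = [N : K_N] ≥ [F₁ : F] ≥ g e f (F₁/F)` (fundamental inequality).

## Content (everything PROVED; `N = K(roots of p) = IntermediateField.adjoin K (p.rootSet Ω)`, `K_N = N ⊓ F`, `N/K_N` rendered as `IntermediateField.extendScalars (inf_le_left : N ⊓ F ≤ N)`, `F₁ = F(roots of p) = IntermediateField.adjoin F (p.rootSet Ω)`)

* `normal_adjoin_rootSet`, `finiteDimensional_adjoin_rootSet`, `algEquiv_apply_mem_adjoin_rootSet`,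
  `adjoin_rootSet_subset`, `normal_extendScalars_inf`, `finiteDimensional_extendScalars_inf` —
  field-theoretic preliminaries. [folklore]
* `exists_algEquiv_restricts` — every `K_N`-automorphism of `N` is the restriction of an
  `F`-automorphism of `F₁`.
* `isDefectlessIn_adjoin_rootSet` — **the base step**: `(F, V ∩ F)` is defectless in `F₁`.

## Sources

* F.-V. Kuhlmann, Trans. AMS 362 (2010) = arXiv:1003.5678, §2.4: Lemma 2.19, Lemma 2.20,
  Prop. 2.24, Cor. 2.25 (p. 8); §2.3, Cor. 2.16 (p. 7).
-/

noncomputable section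

open IsLocalRing Polynomial

namespace Literature.AlgebraicGeometry.Resolution

universe u

variable {K Ω : Type u} [Field K] [Field Ω] [Algebra K Ω] [IsAlgClosed Ω]
  (F₀ : IntermediateField K Ω) (p : K[X])

/-! ### Field-theoretic preliminaries -/

section Fields

omit [IsAlgClosed Ω] in
/-- The roots of `p` over an intermediate field are the roots of `p`. [folklore] -/
theorem rootSet_map_intermediateField :
    (p.map (algebraMap K F₀)).rootSet Ω = p.rootSet Ω := by
  unfold Polynomial.rootSet
  rw [Polynomial.aroots_def, Polynomial.aroots_def, Polynomial.map_map,
    ← IsScalarTower.algebraMap_eq]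

/-- `K(roots of p)` is normal over `K` (a splitting field). [folklore] -/
theorem normal_adjoin_rootSet : Normal K (IntermediateField.adjoin K (p.rootSet Ω) : IntermediateField K Ω) :=
  haveI := IntermediateField.adjoin_rootSet_isSplittingField (IsAlgClosed.splits (p.map (algebraMap K Ω)))
  Normal.of_isSplittingField p

/-- `K(roots of p)` is finite over `K`. [folklore] -/
theorem finiteDimensional_adjoin_rootSet : FiniteDimensional K (IntermediateField.adjoin K (p.rootSet Ω) : IntermediateField K Ω) :=
  haveI := IntermediateField.adjoin_rootSet_isSplittingField (IsAlgClosed.splits (p.map (algebraMap K Ω)))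
  IsSplittingField.finiteDimensional _ p

/-- `F(roots of p)` is normal over `F`. [folklore] -/
theorem normal_adjoin_rootSet_intermediateField : Normal F₀ (IntermediateField.adjoin F₀ (p.rootSet Ω) : IntermediateField F₀ Ω) := by
  rw [← rootSet_map_intermediateField F₀ p]
  haveI := IntermediateField.adjoin_rootSet_isSplittingField
    (IsAlgClosed.splits ((p.map (algebraMap K F₀)).map (algebraMap F₀ Ω)))
  exact Normal.of_isSplittingField (p.map (algebraMap K F₀))

/-- `F(roots of p)` is finite over `F`. [folklore] -/
theorem finiteDimensional_adjoin_rootSet_intermediateField : FiniteDimensional F₀ (IntermediateField.adjoin F₀ (p.rootSet Ω) : IntermediateField F₀ Ω) := by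
  rw [← rootSet_map_intermediateField F₀ p]
  haveI := IntermediateField.adjoin_rootSet_isSplittingField
    (IsAlgClosed.splits ((p.map (algebraMap K F₀)).map (algebraMap F₀ Ω)))
  exact IsSplittingField.finiteDimensional _ (p.map (algebraMap K F₀))

omit [IsAlgClosed Ω] in
/-- `K(roots of p) ⊆ F(roots of p)`. [folklore] -/
theorem adjoin_rootSet_subset : ((IntermediateField.adjoin K (p.rootSet Ω) : IntermediateField K Ω) : Set Ω) ⊆ ((IntermediateField.adjoin F₀ (p.rootSet Ω) : IntermediateField F₀ Ω) : Set Ω) := by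
  have : (IntermediateField.adjoin K (p.rootSet Ω) : IntermediateField K Ω) ≤ (IntermediateField.adjoin F₀ (p.rootSet Ω) : IntermediateField F₀ Ω).restrictScalars K :=
    IntermediateField.adjoin_le_iff.mpr (IntermediateField.subset_adjoin _ _)
  exact this

/-- `K`-automorphisms of `Ω` preserve `K(roots of p)`. [folklore] -/
theorem algEquiv_apply_mem_adjoin_rootSet (φ : Ω ≃ₐ[K] Ω) {x : Ω} (hx : x ∈ (IntermediateField.adjoin K (p.rootSet Ω) : IntermediateField K Ω)) : φ x ∈ (IntermediateField.adjoin K (p.rootSet Ω) : IntermediateField K Ω) := by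
  have hmap : (IntermediateField.adjoin K (p.rootSet Ω) : IntermediateField K Ω).map (φ : Ω →ₐ[K] Ω) = (IntermediateField.adjoin K (p.rootSet Ω) : IntermediateField K Ω) := by
    rw [IntermediateField.adjoin_map]
    congr 1
    exact (IsAlgClosed.splits _).image_rootSet (φ : Ω →ₐ[K] Ω)
  rw [← hmap]
  exact (IntermediateField.mem_map _).mpr ⟨x, hx, rfl⟩

/-- `N` is normal over `K_N = N ∩ F`. [folklore] -/
theorem normal_extendScalars_inf : Normal (IntermediateField.adjoin K (p.rootSet Ω) ⊓ F₀ : IntermediateField K Ω) (IntermediateField.extendScalars (inf_le_left : (IntermediateField.adjoin K (p.rootSet Ω) ⊓ F₀ : IntermediateField K Ω) ≤ IntermediateField.adjoin K (p.rootSet Ω))) := by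
  haveI := normal_adjoin_rootSet (Ω := Ω) p
  let e : (IntermediateField.adjoin K (p.rootSet Ω) : IntermediateField K Ω) ≃ₐ[K] (IntermediateField.extendScalars (inf_le_left : (IntermediateField.adjoin K (p.rootSet Ω) ⊓ F₀ : IntermediateField K Ω) ≤ IntermediateField.adjoin K (p.rootSet Ω))) :=
    { toFun := fun x => ⟨x, x.2⟩
      invFun := fun x => ⟨x, x.2⟩
      left_inv := fun _ => rfl
      right_inv := fun _ => rfl
      map_mul' := fun _ _ => rfl
      map_add' := fun _ _ => rfl
      commutes' := fun _ => rfl }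
  haveI : Normal K (IntermediateField.extendScalars (inf_le_left : (IntermediateField.adjoin K (p.rootSet Ω) ⊓ F₀ : IntermediateField K Ω) ≤ IntermediateField.adjoin K (p.rootSet Ω))) := Normal.of_algEquiv e
  exact Normal.tower_top_of_normal K (IntermediateField.adjoin K (p.rootSet Ω) ⊓ F₀ : IntermediateField K Ω) (IntermediateField.extendScalars (inf_le_left : (IntermediateField.adjoin K (p.rootSet Ω) ⊓ F₀ : IntermediateField K Ω) ≤ IntermediateField.adjoin K (p.rootSet Ω)))

/-- `N` is finite over `K_N`. [folklore] -/
theorem finiteDimensional_extendScalars_inf : FiniteDimensional (IntermediateField.adjoin K (p.rootSet Ω) ⊓ F₀ : IntermediateField K Ω) (IntermediateField.extendScalars (inf_le_left : (IntermediateField.adjoin K (p.rootSet Ω) ⊓ F₀ : IntermediateField K Ω) ≤ IntermediateField.adjoin K (p.rootSet Ω))) := by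
  haveI := finiteDimensional_adjoin_rootSet (Ω := Ω) p
  let e : (IntermediateField.adjoin K (p.rootSet Ω) : IntermediateField K Ω) ≃ₐ[K] (IntermediateField.extendScalars (inf_le_left : (IntermediateField.adjoin K (p.rootSet Ω) ⊓ F₀ : IntermediateField K Ω) ≤ IntermediateField.adjoin K (p.rootSet Ω))) :=
    { toFun := fun x => ⟨x, x.2⟩
      invFun := fun x => ⟨x, x.2⟩
      left_inv := fun _ => rfl
      right_inv := fun _ => rfl
      map_mul' := fun _ _ => rfl
      map_add' := fun _ _ => rfl
      commutes' := fun _ => rfl }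
  haveI : FiniteDimensional K (IntermediateField.extendScalars (inf_le_left : (IntermediateField.adjoin K (p.rootSet Ω) ⊓ F₀ : IntermediateField K Ω) ≤ IntermediateField.adjoin K (p.rootSet Ω))) := LinearEquiv.finiteDimensional e.toLinearEquiv
  exact Module.Finite.of_restrictScalars_finite K (IntermediateField.adjoin K (p.rootSet Ω) ⊓ F₀ : IntermediateField K Ω) (IntermediateField.extendScalars (inf_le_left : (IntermediateField.adjoin K (p.rootSet Ω) ⊓ F₀ : IntermediateField K Ω) ≤ IntermediateField.adjoin K (p.rootSet Ω)))

/-- `K_N` is finite over `K`. [folklore] -/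
theorem finiteDimensional_inf : FiniteDimensional K (IntermediateField.adjoin K (p.rootSet Ω) ⊓ F₀ : IntermediateField K Ω) :=
  haveI := finiteDimensional_adjoin_rootSet (Ω := Ω) p
  FiniteDimensional.of_injective
    (IntermediateField.inclusion (inf_le_left : (IntermediateField.adjoin K (p.rootSet Ω) ⊓ F₀ : IntermediateField K Ω) ≤ (IntermediateField.adjoin K (p.rootSet Ω) : IntermediateField K Ω))).toLinearMap
    (IntermediateField.inclusion_injective inf_le_left)

end Fields

/-! ### Restriction of automorphisms `Aut(F₁/F) → Aut(N/K_N)` and its surjectivity -/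

section Restrict

variable [Algebra.IsAlgebraic F₀ Ω]

/-- `Ω` is an algebraic closure of `F`, hence normal over it. [folklore] -/
theorem normal_of_isAlgClosed_of_isAlgebraic : Normal F₀ Ω :=
  haveI : IsAlgClosure F₀ Ω := ⟨inferInstance, inferInstance⟩
  IsAlgClosure.normal F₀ Ω

/-- An `F`-automorphism of `F₁ = F(roots of p)` maps `N = K(roots of p)` into itself (it extends
to an `F`-automorphism of `Ω`, which permutes the roots of `p`). [folklore] -/
theorem algEquiv_coe_mem_adjoin_rootSet (σ : (IntermediateField.adjoin F₀ (p.rootSet Ω) : IntermediateField F₀ Ω) ≃ₐ[F₀] (IntermediateField.adjoin F₀ (p.rootSet Ω) : IntermediateField F₀ Ω)) (x : (IntermediateField.adjoin F₀ (p.rootSet Ω) : IntermediateField F₀ Ω))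
    (hx : (x : Ω) ∈ (IntermediateField.adjoin K (p.rootSet Ω) : IntermediateField K Ω)) : ((σ x : (IntermediateField.adjoin F₀ (p.rootSet Ω) : IntermediateField F₀ Ω)) : Ω) ∈ (IntermediateField.adjoin K (p.rootSet Ω) : IntermediateField K Ω) := by
  haveI := normal_of_isAlgClosed_of_isAlgebraic F₀
  have hτ : (σ.liftNormal Ω) (x : Ω) = ((σ x : (IntermediateField.adjoin F₀ (p.rootSet Ω) : IntermediateField F₀ Ω)) : Ω) := σ.liftNormal_commutes Ω x
  rw [← hτ]
  exact algEquiv_apply_mem_adjoin_rootSet p ((σ.liftNormal Ω).restrictScalars K) hx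

set_option maxHeartbeats 400000 in
/-- **Every `K_N`-automorphism of `N = K(roots of p)` is the restriction of an `F`-automorphism of
`F₁ = F(roots of p)`** (`K_N = N ∩ F`). PROVED: restriction is a group homomorphism
`ρ : Aut(F₁/F) → Aut(N/K_N)`; an element of `N` fixed by the image of `ρ` is, as an element of
`F₁`, fixed by `Aut(F₁/F)`, hence purely inseparable over `F`
(`exists_pow_mem_range_of_forall_algEquiv`): a `p`-power of it lies in `F ∩ N = K_N`, so it is
fixed by `Aut(N/K_N)` (Frobenius is injective); thus the image has the same fixed field as
`Aut(N/K_N)` and is everything (`IntermediateField.fixingSubgroup_fixedField`). [folklore] -/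
theorem exists_algEquiv_restricts (τ : (IntermediateField.extendScalars (inf_le_left : (IntermediateField.adjoin K (p.rootSet Ω) ⊓ F₀ : IntermediateField K Ω) ≤ IntermediateField.adjoin K (p.rootSet Ω))) ≃ₐ[(IntermediateField.adjoin K (p.rootSet Ω) ⊓ F₀ : IntermediateField K Ω)] (IntermediateField.extendScalars (inf_le_left : (IntermediateField.adjoin K (p.rootSet Ω) ⊓ F₀ : IntermediateField K Ω) ≤ IntermediateField.adjoin K (p.rootSet Ω)))) :
    ∃ σ : (IntermediateField.adjoin F₀ (p.rootSet Ω) : IntermediateField F₀ Ω) ≃ₐ[F₀] (IntermediateField.adjoin F₀ (p.rootSet Ω) : IntermediateField F₀ Ω),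
      ∀ x : (IntermediateField.extendScalars (inf_le_left : (IntermediateField.adjoin K (p.rootSet Ω) ⊓ F₀ : IntermediateField K Ω) ≤ IntermediateField.adjoin K (p.rootSet Ω))), ((σ ⟨(x : Ω), adjoin_rootSet_subset F₀ p x.2⟩ : (IntermediateField.adjoin F₀ (p.rootSet Ω) : IntermediateField F₀ Ω)) : Ω) = ((τ x : (IntermediateField.extendScalars (inf_le_left : (IntermediateField.adjoin K (p.rootSet Ω) ⊓ F₀ : IntermediateField K Ω) ≤ IntermediateField.adjoin K (p.rootSet Ω)))) : Ω) := by
  classical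
  haveI := finiteDimensional_extendScalars_inf (Ω := Ω) F₀ p
  haveI := normal_adjoin_rootSet_intermediateField (Ω := Ω) F₀ p
  haveI : Algebra.IsAlgebraic (IntermediateField.adjoin K (p.rootSet Ω) ⊓ F₀ : IntermediateField K Ω) (IntermediateField.extendScalars (inf_le_left : (IntermediateField.adjoin K (p.rootSet Ω) ⊓ F₀ : IntermediateField K Ω) ≤ IntermediateField.adjoin K (p.rootSet Ω))) := Algebra.IsAlgebraic.of_finite _ _
  -- restriction of `σ ∈ Aut(F₁/F)` to `N`, as a `K_N`-algebra endomorphism of `N`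
  let g : ((IntermediateField.adjoin F₀ (p.rootSet Ω) : IntermediateField F₀ Ω) ≃ₐ[F₀] (IntermediateField.adjoin F₀ (p.rootSet Ω) : IntermediateField F₀ Ω)) → ((IntermediateField.extendScalars (inf_le_left : (IntermediateField.adjoin K (p.rootSet Ω) ⊓ F₀ : IntermediateField K Ω) ≤ IntermediateField.adjoin K (p.rootSet Ω))) →ₐ[(IntermediateField.adjoin K (p.rootSet Ω) ⊓ F₀ : IntermediateField K Ω)] (IntermediateField.extendScalars (inf_le_left : (IntermediateField.adjoin K (p.rootSet Ω) ⊓ F₀ : IntermediateField K Ω) ≤ IntermediateField.adjoin K (p.rootSet Ω)))) :=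
    fun σ =>
    { toFun := fun x => ⟨((σ ⟨(x : Ω), adjoin_rootSet_subset F₀ p x.2⟩ : (IntermediateField.adjoin F₀ (p.rootSet Ω) : IntermediateField F₀ Ω)) : Ω),
        algEquiv_coe_mem_adjoin_rootSet F₀ p σ _ x.2⟩
      map_one' := Subtype.ext (by
        change ((σ ⟨((1 : (IntermediateField.extendScalars (inf_le_left : (IntermediateField.adjoin K (p.rootSet Ω) ⊓ F₀ : IntermediateField K Ω) ≤ IntermediateField.adjoin K (p.rootSet Ω)))) : Ω), _⟩ : (IntermediateField.adjoin F₀ (p.rootSet Ω) : IntermediateField F₀ Ω)) : Ω) = 1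
        have h1 : (⟨((1 : (IntermediateField.extendScalars (inf_le_left : (IntermediateField.adjoin K (p.rootSet Ω) ⊓ F₀ : IntermediateField K Ω) ≤ IntermediateField.adjoin K (p.rootSet Ω)))) : Ω), adjoin_rootSet_subset F₀ p (1 : (IntermediateField.extendScalars (inf_le_left : (IntermediateField.adjoin K (p.rootSet Ω) ⊓ F₀ : IntermediateField K Ω) ≤ IntermediateField.adjoin K (p.rootSet Ω)))).2⟩ : (IntermediateField.adjoin F₀ (p.rootSet Ω) : IntermediateField F₀ Ω)) = 1 :=
          Subtype.ext rfl
        rw [h1, map_one]; rfl)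
      map_mul' := fun x y => Subtype.ext (by
        change ((σ ⟨((x * y : (IntermediateField.extendScalars (inf_le_left : (IntermediateField.adjoin K (p.rootSet Ω) ⊓ F₀ : IntermediateField K Ω) ≤ IntermediateField.adjoin K (p.rootSet Ω)))) : Ω), _⟩ : (IntermediateField.adjoin F₀ (p.rootSet Ω) : IntermediateField F₀ Ω)) : Ω) =
          ((σ ⟨(x : Ω), _⟩ : (IntermediateField.adjoin F₀ (p.rootSet Ω) : IntermediateField F₀ Ω)) : Ω) * ((σ ⟨(y : Ω), _⟩ : (IntermediateField.adjoin F₀ (p.rootSet Ω) : IntermediateField F₀ Ω)) : Ω)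
        have h : (⟨((x * y : (IntermediateField.extendScalars (inf_le_left : (IntermediateField.adjoin K (p.rootSet Ω) ⊓ F₀ : IntermediateField K Ω) ≤ IntermediateField.adjoin K (p.rootSet Ω)))) : Ω), adjoin_rootSet_subset F₀ p (x * y : (IntermediateField.extendScalars (inf_le_left : (IntermediateField.adjoin K (p.rootSet Ω) ⊓ F₀ : IntermediateField K Ω) ≤ IntermediateField.adjoin K (p.rootSet Ω)))).2⟩ : (IntermediateField.adjoin F₀ (p.rootSet Ω) : IntermediateField F₀ Ω)) =
            ⟨(x : Ω), adjoin_rootSet_subset F₀ p x.2⟩ * ⟨(y : Ω), adjoin_rootSet_subset F₀ p y.2⟩ :=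
          Subtype.ext rfl
        rw [h, map_mul]; rfl)
      map_zero' := Subtype.ext (by
        change ((σ ⟨((0 : (IntermediateField.extendScalars (inf_le_left : (IntermediateField.adjoin K (p.rootSet Ω) ⊓ F₀ : IntermediateField K Ω) ≤ IntermediateField.adjoin K (p.rootSet Ω)))) : Ω), _⟩ : (IntermediateField.adjoin F₀ (p.rootSet Ω) : IntermediateField F₀ Ω)) : Ω) = 0
        have h0 : (⟨((0 : (IntermediateField.extendScalars (inf_le_left : (IntermediateField.adjoin K (p.rootSet Ω) ⊓ F₀ : IntermediateField K Ω) ≤ IntermediateField.adjoin K (p.rootSet Ω)))) : Ω), adjoin_rootSet_subset F₀ p (0 : (IntermediateField.extendScalars (inf_le_left : (IntermediateField.adjoin K (p.rootSet Ω) ⊓ F₀ : IntermediateField K Ω) ≤ IntermediateField.adjoin K (p.rootSet Ω)))).2⟩ : (IntermediateField.adjoin F₀ (p.rootSet Ω) : IntermediateField F₀ Ω)) = 0 :=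
          Subtype.ext rfl
        rw [h0, map_zero]; rfl)
      map_add' := fun x y => Subtype.ext (by
        change ((σ ⟨((x + y : (IntermediateField.extendScalars (inf_le_left : (IntermediateField.adjoin K (p.rootSet Ω) ⊓ F₀ : IntermediateField K Ω) ≤ IntermediateField.adjoin K (p.rootSet Ω)))) : Ω), _⟩ : (IntermediateField.adjoin F₀ (p.rootSet Ω) : IntermediateField F₀ Ω)) : Ω) =
          ((σ ⟨(x : Ω), _⟩ : (IntermediateField.adjoin F₀ (p.rootSet Ω) : IntermediateField F₀ Ω)) : Ω) + ((σ ⟨(y : Ω), _⟩ : (IntermediateField.adjoin F₀ (p.rootSet Ω) : IntermediateField F₀ Ω)) : Ω)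
        have h : (⟨((x + y : (IntermediateField.extendScalars (inf_le_left : (IntermediateField.adjoin K (p.rootSet Ω) ⊓ F₀ : IntermediateField K Ω) ≤ IntermediateField.adjoin K (p.rootSet Ω)))) : Ω), adjoin_rootSet_subset F₀ p (x + y : (IntermediateField.extendScalars (inf_le_left : (IntermediateField.adjoin K (p.rootSet Ω) ⊓ F₀ : IntermediateField K Ω) ≤ IntermediateField.adjoin K (p.rootSet Ω)))).2⟩ : (IntermediateField.adjoin F₀ (p.rootSet Ω) : IntermediateField F₀ Ω)) =
            ⟨(x : Ω), adjoin_rootSet_subset F₀ p x.2⟩ + ⟨(y : Ω), adjoin_rootSet_subset F₀ p y.2⟩ :=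
          Subtype.ext rfl
        rw [h, map_add]; rfl)
      commutes' := fun c => Subtype.ext (by
        change ((σ ⟨((algebraMap (IntermediateField.adjoin K (p.rootSet Ω) ⊓ F₀ : IntermediateField K Ω) (IntermediateField.extendScalars (inf_le_left : (IntermediateField.adjoin K (p.rootSet Ω) ⊓ F₀ : IntermediateField K Ω) ≤ IntermediateField.adjoin K (p.rootSet Ω))) c : (IntermediateField.extendScalars (inf_le_left : (IntermediateField.adjoin K (p.rootSet Ω) ⊓ F₀ : IntermediateField K Ω) ≤ IntermediateField.adjoin K (p.rootSet Ω)))) : Ω), _⟩ : (IntermediateField.adjoin F₀ (p.rootSet Ω) : IntermediateField F₀ Ω)) : Ω) = _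
        have hcF : (c : Ω) ∈ F₀ := (IntermediateField.mem_inf.mp c.2).2
        have h : (⟨((algebraMap (IntermediateField.adjoin K (p.rootSet Ω) ⊓ F₀ : IntermediateField K Ω) (IntermediateField.extendScalars (inf_le_left : (IntermediateField.adjoin K (p.rootSet Ω) ⊓ F₀ : IntermediateField K Ω) ≤ IntermediateField.adjoin K (p.rootSet Ω))) c : (IntermediateField.extendScalars (inf_le_left : (IntermediateField.adjoin K (p.rootSet Ω) ⊓ F₀ : IntermediateField K Ω) ≤ IntermediateField.adjoin K (p.rootSet Ω)))) : Ω),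
            adjoin_rootSet_subset F₀ p (algebraMap (IntermediateField.adjoin K (p.rootSet Ω) ⊓ F₀ : IntermediateField K Ω) (IntermediateField.extendScalars (inf_le_left : (IntermediateField.adjoin K (p.rootSet Ω) ⊓ F₀ : IntermediateField K Ω) ≤ IntermediateField.adjoin K (p.rootSet Ω))) c : (IntermediateField.extendScalars (inf_le_left : (IntermediateField.adjoin K (p.rootSet Ω) ⊓ F₀ : IntermediateField K Ω) ≤ IntermediateField.adjoin K (p.rootSet Ω)))).2⟩ : (IntermediateField.adjoin F₀ (p.rootSet Ω) : IntermediateField F₀ Ω)) =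
            algebraMap F₀ (IntermediateField.adjoin F₀ (p.rootSet Ω) : IntermediateField F₀ Ω) ⟨c, hcF⟩ := Subtype.ext rfl
        rw [h, AlgEquiv.commutes]; rfl) }
  have hg : ∀ σ x, ((g σ x : (IntermediateField.extendScalars (inf_le_left : (IntermediateField.adjoin K (p.rootSet Ω) ⊓ F₀ : IntermediateField K Ω) ≤ IntermediateField.adjoin K (p.rootSet Ω)))) : Ω) = ((σ ⟨(x : Ω), adjoin_rootSet_subset F₀ p x.2⟩ : (IntermediateField.adjoin F₀ (p.rootSet Ω) : IntermediateField F₀ Ω)) : Ω) :=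
    fun _ _ => rfl
  -- as a group homomorphism `ρ : Aut(F₁/F) → Aut(N/K_N)`
  let ρ : ((IntermediateField.adjoin F₀ (p.rootSet Ω) : IntermediateField F₀ Ω) ≃ₐ[F₀] (IntermediateField.adjoin F₀ (p.rootSet Ω) : IntermediateField F₀ Ω)) →* ((IntermediateField.extendScalars (inf_le_left : (IntermediateField.adjoin K (p.rootSet Ω) ⊓ F₀ : IntermediateField K Ω) ≤ IntermediateField.adjoin K (p.rootSet Ω))) ≃ₐ[(IntermediateField.adjoin K (p.rootSet Ω) ⊓ F₀ : IntermediateField K Ω)] (IntermediateField.extendScalars (inf_le_left : (IntermediateField.adjoin K (p.rootSet Ω) ⊓ F₀ : IntermediateField K Ω) ≤ IntermediateField.adjoin K (p.rootSet Ω)))) :=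
    { toFun := fun σ => AlgEquiv.ofBijective (g σ) (Algebra.IsAlgebraic.algHom_bijective (g σ))
      map_one' := by
        ext x
        change ((g 1 x : (IntermediateField.extendScalars (inf_le_left : (IntermediateField.adjoin K (p.rootSet Ω) ⊓ F₀ : IntermediateField K Ω) ≤ IntermediateField.adjoin K (p.rootSet Ω)))) : Ω) = (x : Ω)
        rw [hg, AlgEquiv.one_apply]
      map_mul' := fun σ σ' => by
        ext x
        change ((g (σ * σ') x : (IntermediateField.extendScalars (inf_le_left : (IntermediateField.adjoin K (p.rootSet Ω) ⊓ F₀ : IntermediateField K Ω) ≤ IntermediateField.adjoin K (p.rootSet Ω)))) : Ω) = ((g σ (g σ' x) : (IntermediateField.extendScalars (inf_le_left : (IntermediateField.adjoin K (p.rootSet Ω) ⊓ F₀ : IntermediateField K Ω) ≤ IntermediateField.adjoin K (p.rootSet Ω)))) : Ω)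
        rw [hg, hg, AlgEquiv.mul_apply]
        rfl }
  have hρ : ∀ σ x, ((ρ σ x : (IntermediateField.extendScalars (inf_le_left : (IntermediateField.adjoin K (p.rootSet Ω) ⊓ F₀ : IntermediateField K Ω) ≤ IntermediateField.adjoin K (p.rootSet Ω)))) : Ω) = ((σ ⟨(x : Ω), adjoin_rootSet_subset F₀ p x.2⟩ : (IntermediateField.adjoin F₀ (p.rootSet Ω) : IntermediateField F₀ Ω)) : Ω) :=
    fun _ _ => rfl
  -- the fixed field of the image of `ρ` is fixed by everything
  set H := ρ.range with hH
  have hfix : ∀ x : (IntermediateField.extendScalars (inf_le_left : (IntermediateField.adjoin K (p.rootSet Ω) ⊓ F₀ : IntermediateField K Ω) ≤ IntermediateField.adjoin K (p.rootSet Ω))), x ∈ IntermediateField.fixedField H →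
      ∀ g' : (IntermediateField.extendScalars (inf_le_left : (IntermediateField.adjoin K (p.rootSet Ω) ⊓ F₀ : IntermediateField K Ω) ≤ IntermediateField.adjoin K (p.rootSet Ω))) ≃ₐ[(IntermediateField.adjoin K (p.rootSet Ω) ⊓ F₀ : IntermediateField K Ω)] (IntermediateField.extendScalars (inf_le_left : (IntermediateField.adjoin K (p.rootSet Ω) ⊓ F₀ : IntermediateField K Ω) ≤ IntermediateField.adjoin K (p.rootSet Ω))), g' x = x := by
    intro x hx g'
    rw [IntermediateField.mem_fixedField_iff] at hx
    -- `x ∈ F₁` is fixed by `Aut(F₁/F)`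
    set xF : (IntermediateField.adjoin F₀ (p.rootSet Ω) : IntermediateField F₀ Ω) := ⟨(x : Ω), adjoin_rootSet_subset F₀ p x.2⟩ with hxF
    have hxF_fixed : ∀ σ : (IntermediateField.adjoin F₀ (p.rootSet Ω) : IntermediateField F₀ Ω) ≃ₐ[F₀] (IntermediateField.adjoin F₀ (p.rootSet Ω) : IntermediateField F₀ Ω), σ xF = xF := by
      intro σ
      apply Subtype.ext
      rw [← hρ]
      exact congrArg (fun y : (IntermediateField.extendScalars (inf_le_left : (IntermediateField.adjoin K (p.rootSet Ω) ⊓ F₀ : IntermediateField K Ω) ≤ IntermediateField.adjoin K (p.rootSet Ω))) => (y : Ω)) (hx (ρ σ) ⟨σ, rfl⟩)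
    -- hence a `p`-power of `x` lies in `F`, i.e. in `K_N`
    obtain ⟨n, c, hc⟩ := exists_pow_mem_range_of_forall_algEquiv F₀ xF hxF_fixed
    set q : ℕ := ringExpChar F₀ with hq
    have hcΩ : ((c : F₀) : Ω) = (x : Ω) ^ q ^ n := by
      have := congrArg (fun y : (IntermediateField.adjoin F₀ (p.rootSet Ω) : IntermediateField F₀ Ω) => (y : Ω)) hc
      simpa using this
    have hmemN : (x : Ω) ^ q ^ n ∈ (IntermediateField.adjoin K (p.rootSet Ω) : IntermediateField K Ω) := pow_mem x.2 _
    set d : (IntermediateField.adjoin K (p.rootSet Ω) ⊓ F₀ : IntermediateField K Ω) := ⟨(x : Ω) ^ q ^ n,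
      IntermediateField.mem_inf.mpr ⟨hmemN, hcΩ ▸ c.2⟩⟩ with hd
    have hxd : x ^ q ^ n = algebraMap (IntermediateField.adjoin K (p.rootSet Ω) ⊓ F₀ : IntermediateField K Ω) (IntermediateField.extendScalars (inf_le_left : (IntermediateField.adjoin K (p.rootSet Ω) ⊓ F₀ : IntermediateField K Ω) ≤ IntermediateField.adjoin K (p.rootSet Ω))) d := Subtype.ext rfl
    -- so `g'` fixes `x ^ q ^ n`, hence `x`
    have hgx : (g' x) ^ q ^ n = x ^ q ^ n := by rw [← map_pow, hxd, AlgEquiv.commutes]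
    haveI : ExpChar Ω q := expChar_of_injective_algebraMap (algebraMap F₀ Ω).injective q
    haveI : ExpChar (IntermediateField.extendScalars (inf_le_left : (IntermediateField.adjoin K (p.rootSet Ω) ⊓ F₀ : IntermediateField K Ω) ≤ IntermediateField.adjoin K (p.rootSet Ω))) q := RingHom.expChar (algebraMap (IntermediateField.extendScalars (inf_le_left : (IntermediateField.adjoin K (p.rootSet Ω) ⊓ F₀ : IntermediateField K Ω) ≤ IntermediateField.adjoin K (p.rootSet Ω))) Ω) (algebraMap (IntermediateField.extendScalars (inf_le_left : (IntermediateField.adjoin K (p.rootSet Ω) ⊓ F₀ : IntermediateField K Ω) ≤ IntermediateField.adjoin K (p.rootSet Ω))) Ω).injective q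
    exact iterateFrobenius_inj (IntermediateField.extendScalars (inf_le_left : (IntermediateField.adjoin K (p.rootSet Ω) ⊓ F₀ : IntermediateField K Ω) ≤ IntermediateField.adjoin K (p.rootSet Ω))) q n (by simpa [iterateFrobenius_def] using hgx)
  -- so `H` is everything
  have htop : H = ⊤ := by
    rw [← IntermediateField.fixingSubgroup_fixedField H]
    refine eq_top_iff.mpr fun g' _ => (IntermediateField.mem_fixingSubgroup_iff _ _).mpr ?_
    intro x hx
    exact hfix x hx g'
  have hτ : τ ∈ H := by rw [htop]; exact Subgroup.mem_top τ
  obtain ⟨σ, hσ⟩ := MonoidHom.mem_range.mp hτ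
  exact ⟨σ, fun x => by rw [← hρ, hσ]⟩

end Restrict

/-! ### The base step: `F` is defectless in `F₁ = F·N` -/

section Base

variable (V : ValuationSubring Ω) [Algebra.IsAlgebraic F₀ Ω]

omit [IsAlgClosed Ω] [Algebra.IsAlgebraic F₀ Ω] in
/-- The range of `A → Ω` for an intermediate field `A` is `A`. [folklore] -/
theorem coe_range_algebraMap_intermediateField {k : Type u} [Field k] [Algebra k Ω]
    (A : IntermediateField k Ω) : Set.range (algebraMap A Ω) = (A : Set Ω) :=
  Subtype.range_coe

/-- **Kuhlmann 2010, Cor. 2.25 at finite level, base step** (the counting form of Prop. 2.24):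
let `K ⊆ F ⊆ Ω` with `Ω` algebraically closed and algebraic over `F`, `V` a valuation ring of
`Ω`, and assume that `vF/vK` is torsion free (inside `vΩ`), `Fv = Kv` (inside `Ωv`) and that
`(K, V ∩ K)` is a defectless field. Then for every `p ∈ K[X]`, `(F, V ∩ F)` is defectless in
`F₁ = F(roots of p) = F·N`, `N = K(roots of p)`: with `K_N = N ∩ F`,
`g e f (F₁/F) ≥ g e f (N/K_N) = [N : K_N] ≥ [F₁ : F] ≥ g e f (F₁/F)`. PROVED (see the module
docstring). [cite: Kuhlmann2010, Prop. 2.24 and Cor. 2.25] -/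
theorem isDefectlessIn_adjoin_rootSet
    (hTF : ∀ γ : (V.ValueGroup)ˣ, γ ∈ valueSubgroup F₀ V → ∀ n : ℕ, 0 < n →
      γ ^ n ∈ valueSubgroup K V → γ ∈ valueSubgroup K V)
    (hRes : residueSubfield F₀ V ≤ residueSubfield K V)
    (hDK : IsDefectlessField K (V.comap (algebraMap K Ω))) :
    IsDefectlessIn F₀ (V.comap (algebraMap F₀ Ω)) (IntermediateField.adjoin F₀ (p.rootSet Ω) : IntermediateField F₀ Ω) := by
  classical
  haveI := finiteDimensional_extendScalars_inf (Ω := Ω) F₀ p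
  haveI := normal_extendScalars_inf (Ω := Ω) F₀ p
  haveI := finiteDimensional_adjoin_rootSet_intermediateField (Ω := Ω) F₀ p
  haveI := normal_adjoin_rootSet_intermediateField (Ω := Ω) F₀ p
  haveI := finiteDimensional_inf (Ω := Ω) F₀ p
  haveI := finiteDimensional_adjoin_rootSet (Ω := Ω) p
  -- the valuation rings
  set O : ValuationSubring F₀ := V.comap (algebraMap F₀ Ω) with hO
  set WF : ValuationSubring (IntermediateField.adjoin F₀ (p.rootSet Ω) : IntermediateField F₀ Ω) := V.comap (algebraMap (IntermediateField.adjoin F₀ (p.rootSet Ω) : IntermediateField F₀ Ω) Ω) with hWFdef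
  set WN : ValuationSubring (IntermediateField.extendScalars (inf_le_left : (IntermediateField.adjoin K (p.rootSet Ω) ⊓ F₀ : IntermediateField K Ω) ≤ IntermediateField.adjoin K (p.rootSet Ω))) := V.comap (algebraMap (IntermediateField.extendScalars (inf_le_left : (IntermediateField.adjoin K (p.rootSet Ω) ⊓ F₀ : IntermediateField K Ω) ≤ IntermediateField.adjoin K (p.rootSet Ω))) Ω) with hWNdef
  set OKN : ValuationSubring (IntermediateField.adjoin K (p.rootSet Ω) ⊓ F₀ : IntermediateField K Ω) := V.comap (algebraMap (IntermediateField.adjoin K (p.rootSet Ω) ⊓ F₀ : IntermediateField K Ω) Ω) with hOKN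
  have hWF : WF.comap (algebraMap F₀ (IntermediateField.adjoin F₀ (p.rootSet Ω) : IntermediateField F₀ Ω)) = O := by
    rw [hWFdef, ValuationSubring.comap_comap]; rfl
  have hWN : WN.comap (algebraMap (IntermediateField.adjoin K (p.rootSet Ω) ⊓ F₀ : IntermediateField K Ω) (IntermediateField.extendScalars (inf_le_left : (IntermediateField.adjoin K (p.rootSet Ω) ⊓ F₀ : IntermediateField K Ω) ≤ IntermediateField.adjoin K (p.rootSet Ω)))) = OKN := by
    rw [hWNdef, ValuationSubring.comap_comap]; rfl
  -- ranges
  have hKKN : Set.range (algebraMap K Ω) ⊆ Set.range (algebraMap (IntermediateField.adjoin K (p.rootSet Ω) ⊓ F₀ : IntermediateField K Ω) Ω) := by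
    rintro _ ⟨c, rfl⟩
    exact ⟨⟨algebraMap K Ω c, algebraMap_mem _ c⟩, rfl⟩
  have hKF₀ : Set.range (algebraMap K Ω) ⊆ Set.range (algebraMap F₀ Ω) := by
    rintro _ ⟨c, rfl⟩
    exact ⟨algebraMap K F₀ c, rfl⟩
  have hKNF₀ : Set.range (algebraMap (IntermediateField.adjoin K (p.rootSet Ω) ⊓ F₀ : IntermediateField K Ω) Ω) ⊆ Set.range (algebraMap F₀ Ω) := by
    rw [coe_range_algebraMap_intermediateField, coe_range_algebraMap_intermediateField]
    exact fun x hx => (IntermediateField.mem_inf.mp hx).2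
  have hKNN : Set.range (algebraMap (IntermediateField.adjoin K (p.rootSet Ω) ⊓ F₀ : IntermediateField K Ω) Ω) ⊆ Set.range (algebraMap (IntermediateField.extendScalars (inf_le_left : (IntermediateField.adjoin K (p.rootSet Ω) ⊓ F₀ : IntermediateField K Ω) ≤ IntermediateField.adjoin K (p.rootSet Ω))) Ω) := by
    rw [coe_range_algebraMap_intermediateField, coe_range_algebraMap_intermediateField]
    exact fun x hx => (IntermediateField.mem_inf.mp hx).1
  have hNF : Set.range (algebraMap (IntermediateField.extendScalars (inf_le_left : (IntermediateField.adjoin K (p.rootSet Ω) ⊓ F₀ : IntermediateField K Ω) ≤ IntermediateField.adjoin K (p.rootSet Ω))) Ω) ⊆ Set.range (algebraMap (IntermediateField.adjoin F₀ (p.rootSet Ω) : IntermediateField F₀ Ω) Ω) := by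
    rw [coe_range_algebraMap_intermediateField, coe_range_algebraMap_intermediateField]
    exact adjoin_rootSet_subset F₀ p
  -- `K_N` is a defectless field (Cor. 2.16)
  have hKN : IsDefectlessField (IntermediateField.adjoin K (p.rootSet Ω) ⊓ F₀ : IntermediateField K Ω) OKN := by
    refine IsDefectlessField.finiteDimensional (K := K) OKN ?_
    rw [hOKN, ValuationSubring.comap_comap]
    exact hDK
  -- all extensions over `N/K_N` and over `F₁/F`
  obtain ⟨sN, hsN, hsumN⟩ := hKN (IntermediateField.extendScalars (inf_le_left : (IntermediateField.adjoin K (p.rootSet Ω) ⊓ F₀ : IntermediateField K Ω) ≤ IntermediateField.adjoin K (p.rootSet Ω))) inferInstance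
  obtain ⟨sF, hsF, hleF⟩ := FundamentalInequality_holds F₀ (IntermediateField.adjoin F₀ (p.rootSet Ω) : IntermediateField F₀ Ω) inferInstance O
  -- conjugacy: `∑ e f = g · e f`
  have hsumN' : ∑ W' ∈ sN, ramificationIndex (IntermediateField.adjoin K (p.rootSet Ω) ⊓ F₀ : IntermediateField K Ω) W' *
      inertiaDegree (IntermediateField.adjoin K (p.rootSet Ω) ⊓ F₀ : IntermediateField K Ω) W' =
      sN.card * (ramificationIndex (IntermediateField.adjoin K (p.rootSet Ω) ⊓ F₀ : IntermediateField K Ω) WN *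
        inertiaDegree (IntermediateField.adjoin K (p.rootSet Ω) ⊓ F₀ : IntermediateField K Ω) WN) :=
    sum_ramificationIndex_mul_inertiaDegree_eq_card_mul _ sN WN fun W' => by rw [hsN, hWN]
  have hsumF' : ∑ W' ∈ sF, ramificationIndex F₀ W' * inertiaDegree F₀ W' =
      sF.card * (ramificationIndex F₀ WF * inertiaDegree F₀ WF) :=
    sum_ramificationIndex_mul_inertiaDegree_eq_card_mul _ sF WF fun W' => by rw [hsF, hWF]
  -- `e, f ≥ 1`
  obtain ⟨heF1, hfF1⟩ := one_le_ramificationIndex_and_inertiaDegree F₀ WF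
  -- `e(F₁/F) ≥ e(N/K_N)`
  have he : ramificationIndex (IntermediateField.adjoin K (p.rootSet Ω) ⊓ F₀ : IntermediateField K Ω) WN ≤ ramificationIndex F₀ WF := by
    rw [hWFdef, hWNdef, ramificationIndex_comap_eq_relIndex V F₀ (IntermediateField.adjoin F₀ (p.rootSet Ω) : IntermediateField F₀ Ω),
      ramificationIndex_comap_eq_relIndex V (IntermediateField.adjoin K (p.rootSet Ω) ⊓ F₀ : IntermediateField K Ω) (IntermediateField.extendScalars (inf_le_left : (IntermediateField.adjoin K (p.rootSet Ω) ⊓ F₀ : IntermediateField K Ω) ≤ IntermediateField.adjoin K (p.rootSet Ω)))]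
    have halg : ∀ x : (IntermediateField.extendScalars (inf_le_left : (IntermediateField.adjoin K (p.rootSet Ω) ⊓ F₀ : IntermediateField K Ω) ≤ IntermediateField.adjoin K (p.rootSet Ω))), IsAlgebraic (algebraMap K Ω).fieldRange (algebraMap (IntermediateField.extendScalars (inf_le_left : (IntermediateField.adjoin K (p.rootSet Ω) ⊓ F₀ : IntermediateField K Ω) ≤ IntermediateField.adjoin K (p.rootSet Ω))) Ω x) := by
      intro x
      letI : Algebra K (algebraMap K Ω).fieldRange := (algebraMap K Ω).rangeRestrictField.toAlgebra
      haveI : IsScalarTower K (algebraMap K Ω).fieldRange Ω :=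
        IsScalarTower.of_algebraMap_eq fun _ => rfl
      have hx : IsAlgebraic K ((⟨(x : Ω), x.2⟩ : (IntermediateField.adjoin K (p.rootSet Ω) : IntermediateField K Ω)) : Ω) :=
        IntermediateField.isAlgebraic_iff.mp (Algebra.IsAlgebraic.isAlgebraic _)
      exact hx.extendScalars (algebraMap K (algebraMap K Ω).fieldRange).injective
    refine relIndex_le_relIndex_of_inf_le (valueSubgroup_le_of_range_subset V hKNF₀)
      (valueSubgroup_le_of_range_subset V hNF) (valueSubgroup_le_of_range_subset V hKNN)
      ((inf_valueSubgroup_le_of_isAlgebraic V hTF halg).trans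
        (valueSubgroup_le_of_range_subset V hKKN)) ?_
    rw [← ramificationIndex_comap_eq_relIndex V F₀ (IntermediateField.adjoin F₀ (p.rootSet Ω) : IntermediateField F₀ Ω)]
    exact Nat.one_le_iff_ne_zero.mp heF1
  -- `f(F₁/F) ≥ f(N/K_N)`
  have hf : inertiaDegree (IntermediateField.adjoin K (p.rootSet Ω) ⊓ F₀ : IntermediateField K Ω) WN ≤ inertiaDegree F₀ WF := by
    rw [hWFdef, hWNdef, inertiaDegree_comap_eq_relfinrank V F₀ (IntermediateField.adjoin F₀ (p.rootSet Ω) : IntermediateField F₀ Ω),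
      inertiaDegree_comap_eq_relfinrank V (IntermediateField.adjoin K (p.rootSet Ω) ⊓ F₀ : IntermediateField K Ω) (IntermediateField.extendScalars (inf_le_left : (IntermediateField.adjoin K (p.rootSet Ω) ⊓ F₀ : IntermediateField K Ω) ≤ IntermediateField.adjoin K (p.rootSet Ω)))]
    have hRF : residueSubfield F₀ V = residueSubfield K V :=
      le_antisymm hRes (residueSubfield_le_of_range_subset V hKF₀)
    have h1 : residueSubfield K V ≤ residueSubfield (IntermediateField.adjoin K (p.rootSet Ω) ⊓ F₀ : IntermediateField K Ω) V :=
      residueSubfield_le_of_range_subset V hKKN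
    have h2 : residueSubfield (IntermediateField.adjoin K (p.rootSet Ω) ⊓ F₀ : IntermediateField K Ω) V ≤ residueSubfield (IntermediateField.extendScalars (inf_le_left : (IntermediateField.adjoin K (p.rootSet Ω) ⊓ F₀ : IntermediateField K Ω) ≤ IntermediateField.adjoin K (p.rootSet Ω))) V :=
      residueSubfield_le_of_range_subset V hKNN
    have h3 : residueSubfield (IntermediateField.extendScalars (inf_le_left : (IntermediateField.adjoin K (p.rootSet Ω) ⊓ F₀ : IntermediateField K Ω) ≤ IntermediateField.adjoin K (p.rootSet Ω))) V ≤ residueSubfield (IntermediateField.adjoin F₀ (p.rootSet Ω) : IntermediateField F₀ Ω) V :=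
      residueSubfield_le_of_range_subset V hNF
    have hne : (residueSubfield F₀ V).relfinrank (residueSubfield (IntermediateField.adjoin F₀ (p.rootSet Ω) : IntermediateField F₀ Ω) V) ≠ 0 := by
      rw [← inertiaDegree_comap_eq_relfinrank V F₀ (IntermediateField.adjoin F₀ (p.rootSet Ω) : IntermediateField F₀ Ω)]
      exact Nat.one_le_iff_ne_zero.mp hfF1
    rw [hRF] at hne ⊢
    rw [← Subfield.relfinrank_mul_relfinrank h1 (h2.trans h3),
      ← Subfield.relfinrank_mul_relfinrank h2 h3] at hne ⊢
    have ha : (residueSubfield K V).relfinrank (residueSubfield (IntermediateField.adjoin K (p.rootSet Ω) ⊓ F₀ : IntermediateField K Ω) V) ≠ 0 :=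
      fun h => hne (by rw [h, zero_mul])
    have hc : (residueSubfield (IntermediateField.extendScalars (inf_le_left : (IntermediateField.adjoin K (p.rootSet Ω) ⊓ F₀ : IntermediateField K Ω) ≤ IntermediateField.adjoin K (p.rootSet Ω))) V).relfinrank (residueSubfield (IntermediateField.adjoin F₀ (p.rootSet Ω) : IntermediateField F₀ Ω) V) ≠ 0 :=
      fun h => hne (by rw [h, mul_zero, mul_zero])
    calc (residueSubfield (IntermediateField.adjoin K (p.rootSet Ω) ⊓ F₀ : IntermediateField K Ω) V).relfinrank (residueSubfield (IntermediateField.extendScalars (inf_le_left : (IntermediateField.adjoin K (p.rootSet Ω) ⊓ F₀ : IntermediateField K Ω) ≤ IntermediateField.adjoin K (p.rootSet Ω))) V)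
        ≤ (residueSubfield (IntermediateField.adjoin K (p.rootSet Ω) ⊓ F₀ : IntermediateField K Ω) V).relfinrank (residueSubfield (IntermediateField.extendScalars (inf_le_left : (IntermediateField.adjoin K (p.rootSet Ω) ⊓ F₀ : IntermediateField K Ω) ≤ IntermediateField.adjoin K (p.rootSet Ω))) V) *
            (residueSubfield (IntermediateField.extendScalars (inf_le_left : (IntermediateField.adjoin K (p.rootSet Ω) ⊓ F₀ : IntermediateField K Ω) ≤ IntermediateField.adjoin K (p.rootSet Ω))) V).relfinrank (residueSubfield (IntermediateField.adjoin F₀ (p.rootSet Ω) : IntermediateField F₀ Ω) V) :=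
          Nat.le_mul_of_pos_right _ (Nat.pos_of_ne_zero hc)
      _ ≤ (residueSubfield K V).relfinrank (residueSubfield (IntermediateField.adjoin K (p.rootSet Ω) ⊓ F₀ : IntermediateField K Ω) V) *
            ((residueSubfield (IntermediateField.adjoin K (p.rootSet Ω) ⊓ F₀ : IntermediateField K Ω) V).relfinrank (residueSubfield (IntermediateField.extendScalars (inf_le_left : (IntermediateField.adjoin K (p.rootSet Ω) ⊓ F₀ : IntermediateField K Ω) ≤ IntermediateField.adjoin K (p.rootSet Ω))) V) *
              (residueSubfield (IntermediateField.extendScalars (inf_le_left : (IntermediateField.adjoin K (p.rootSet Ω) ⊓ F₀ : IntermediateField K Ω) ≤ IntermediateField.adjoin K (p.rootSet Ω))) V).relfinrank (residueSubfield (IntermediateField.adjoin F₀ (p.rootSet Ω) : IntermediateField F₀ Ω) V)) :=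
          Nat.le_mul_of_pos_left _ (Nat.pos_of_ne_zero ha)
  -- `[F₁ : F] ≤ [N : K_N]`
  have hdeg : Module.finrank F₀ (IntermediateField.adjoin F₀ (p.rootSet Ω) : IntermediateField F₀ Ω) ≤ Module.finrank (IntermediateField.adjoin K (p.rootSet Ω) ⊓ F₀ : IntermediateField K Ω) (IntermediateField.extendScalars (inf_le_left : (IntermediateField.adjoin K (p.rootSet Ω) ⊓ F₀ : IntermediateField K Ω) ≤ IntermediateField.adjoin K (p.rootSet Ω))) := by
    letI : Algebra (IntermediateField.adjoin K (p.rootSet Ω) ⊓ F₀ : IntermediateField K Ω) F₀ :=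
      (IntermediateField.inclusion (inf_le_right : (IntermediateField.adjoin K (p.rootSet Ω) ⊓ F₀ : IntermediateField K Ω) ≤ F₀)).toRingHom.toAlgebra
    haveI : IsScalarTower (IntermediateField.adjoin K (p.rootSet Ω) ⊓ F₀ : IntermediateField K Ω) F₀ Ω :=
      IsScalarTower.of_algebraMap_eq fun _ => rfl
    haveI : Algebra.IsAlgebraic (IntermediateField.adjoin K (p.rootSet Ω) ⊓ F₀ : IntermediateField K Ω) (IntermediateField.extendScalars (inf_le_left : (IntermediateField.adjoin K (p.rootSet Ω) ⊓ F₀ : IntermediateField K Ω) ≤ IntermediateField.adjoin K (p.rootSet Ω))) := Algebra.IsAlgebraic.of_finite _ _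
    have h := IntermediateField.adjoin_rank_le_of_isAlgebraic_right (F := (IntermediateField.adjoin K (p.rootSet Ω) ⊓ F₀ : IntermediateField K Ω))
      F₀ (K := Ω) (IntermediateField.extendScalars (inf_le_left : (IntermediateField.adjoin K (p.rootSet Ω) ⊓ F₀ : IntermediateField K Ω) ≤ IntermediateField.adjoin K (p.rootSet Ω)))
    have hadj : IntermediateField.adjoin F₀ ((IntermediateField.extendScalars (inf_le_left : (IntermediateField.adjoin K (p.rootSet Ω) ⊓ F₀ : IntermediateField K Ω) ≤ IntermediateField.adjoin K (p.rootSet Ω))) : Set Ω) = (IntermediateField.adjoin F₀ (p.rootSet Ω) : IntermediateField F₀ Ω) := by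
      apply le_antisymm
      · exact IntermediateField.adjoin_le_iff.mpr (adjoin_rootSet_subset F₀ p)
      · exact IntermediateField.adjoin_le_iff.mpr
          ((IntermediateField.subset_adjoin K (p.rootSet Ω)).trans
            (IntermediateField.subset_adjoin F₀ _))
    rw [hadj] at h
    exact Cardinal.toNat_le_toNat h (Module.rank_lt_aleph0 _ _)
  -- `g(F₁/F) ≥ g(N/K_N)`: every extension over `N/K_N` is the restriction of one over `F₁/F`
  have hcard : sN.card ≤ sF.card := by
    let ι : (IntermediateField.extendScalars (inf_le_left : (IntermediateField.adjoin K (p.rootSet Ω) ⊓ F₀ : IntermediateField K Ω) ≤ IntermediateField.adjoin K (p.rootSet Ω))) →+* ((IntermediateField.adjoin F₀ (p.rootSet Ω) : IntermediateField F₀ Ω)) :=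
      { toFun := fun x => ⟨(x : Ω), adjoin_rootSet_subset F₀ p x.2⟩
        map_one' := rfl
        map_mul' := fun _ _ => rfl
        map_zero' := rfl
        map_add' := fun _ _ => rfl }
    refine Finset.card_le_card_of_surjOn (fun W : ValuationSubring (IntermediateField.adjoin F₀ (p.rootSet Ω) : IntermediateField F₀ Ω) => W.comap ι) ?_
    intro U hU
    have hU' : WN.comap (algebraMap (IntermediateField.adjoin K (p.rootSet Ω) ⊓ F₀ : IntermediateField K Ω) (IntermediateField.extendScalars (inf_le_left : (IntermediateField.adjoin K (p.rootSet Ω) ⊓ F₀ : IntermediateField K Ω) ≤ IntermediateField.adjoin K (p.rootSet Ω)))) =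
        U.comap (algebraMap (IntermediateField.adjoin K (p.rootSet Ω) ⊓ F₀ : IntermediateField K Ω) (IntermediateField.extendScalars (inf_le_left : (IntermediateField.adjoin K (p.rootSet Ω) ⊓ F₀ : IntermediateField K Ω) ≤ IntermediateField.adjoin K (p.rootSet Ω)))) := by
      rw [(hsN U).mp hU, hWN]
    obtain ⟨τ, hτ⟩ := exists_algEquiv_comap_eq (IntermediateField.adjoin K (p.rootSet Ω) ⊓ F₀ : IntermediateField K Ω) WN U hU'
    obtain ⟨σ, hσ⟩ := exists_algEquiv_restricts F₀ p τ
    refine ⟨WF.comap (σ : (IntermediateField.adjoin F₀ (p.rootSet Ω) : IntermediateField F₀ Ω) →+* (IntermediateField.adjoin F₀ (p.rootSet Ω) : IntermediateField F₀ Ω)), ?_, ?_⟩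
    · change WF.comap (σ : (IntermediateField.adjoin F₀ (p.rootSet Ω) : IntermediateField F₀ Ω) →+* (IntermediateField.adjoin F₀ (p.rootSet Ω) : IntermediateField F₀ Ω)) ∈ sF
      rw [hsF, comap_algEquiv_comap_algebraMap, hWF]
    · change (WF.comap (σ : (IntermediateField.adjoin F₀ (p.rootSet Ω) : IntermediateField F₀ Ω) →+* (IntermediateField.adjoin F₀ (p.rootSet Ω) : IntermediateField F₀ Ω))).comap ι = U
      rw [← hτ]
      ext x
      simp only [ValuationSubring.mem_comap, hWFdef, hWNdef]
      change ((σ (ι x) : (IntermediateField.adjoin F₀ (p.rootSet Ω) : IntermediateField F₀ Ω)) : Ω) ∈ V ↔ ((τ x : (IntermediateField.extendScalars (inf_le_left : (IntermediateField.adjoin K (p.rootSet Ω) ⊓ F₀ : IntermediateField K Ω) ≤ IntermediateField.adjoin K (p.rootSet Ω)))) : Ω) ∈ V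
      rw [← hσ x]
      rfl
  -- the chain of inequalities closes up
  have h1 : sF.card * (ramificationIndex F₀ WF * inertiaDegree F₀ WF) ≤ Module.finrank F₀ (IntermediateField.adjoin F₀ (p.rootSet Ω) : IntermediateField F₀ Ω) := by
    rw [← hsumF']; exact hleF
  have h2 : Module.finrank (IntermediateField.adjoin K (p.rootSet Ω) ⊓ F₀ : IntermediateField K Ω) (IntermediateField.extendScalars (inf_le_left : (IntermediateField.adjoin K (p.rootSet Ω) ⊓ F₀ : IntermediateField K Ω) ≤ IntermediateField.adjoin K (p.rootSet Ω))) ≤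
      sF.card * (ramificationIndex F₀ WF * inertiaDegree F₀ WF) := by
    rw [← hsumN, hsumN']
    exact Nat.mul_le_mul hcard (Nat.mul_le_mul he hf)
  refine ⟨sF, hsF, ?_⟩
  rw [hsumF']
  exact le_antisymm h1 (hdeg.trans h2)

end Base

end Literature.AlgebraicGeometry.Resolution
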